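import Mathlib.Analysis.Calculus.Deriv.MeanValue

/-!
# Route EIHFluxBalance — `InertialRecession`, re-charting: the ADAPTED MESHING PROFILE (clock slack
# versus slab tilt for holes with wandering velocities)

Helper file for the crux `stmt-FinalStateConjecture-10166`
(`Summit.FinalStateConjecture.FinalStateConjecture.Theses.EIHFluxBalance.InertialRecession`),
stub `stub_rechart` (the transfer P2 of line `sublinear-is-free-clean-window-charges`).

The transfer with a general clock dictionary (…RechartTransfer3) asks, on the lab slab `{x⁰ = t}`,
that chart points within the meshing radius `Rb(t)` of hole `i` have model time `≤ t`:
`θᵢ(t) + βᵢ(t) Rb(t) ≤ t`, i.e. the TILT `βᵢ(t)Rb(t)` of the rest slab across the tube must stay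
below the accumulated CLOCK SLACK `s(t) = t − θᵢ(t)` (`= ∫(ũ⁰ − 1) +` const for the proper-time clock).
For holes whose painted velocity wanders (Cesàro velocities only) neither is `βᵢ → 0` nor `s → ∞`
guaranteed, but they are COUPLED: the slack grows at rate `ṡ = 1 − 1/ũ⁰ ≥ c β²` (`β ≍ γ|v|` with
the SHARP tilt bound `abs_frameTilt_le`, NOT the crude `16γ²`), while slaving makes `β̇ → 0`. This
file proves that the coupling suffices: `exists_adapted_profile` — if `s' ≥ c β²`, `s ≥ s₀ > 0`,
`0 ≤ β ≤ B`, `β' → 0`, then for every monotone cap `→ ∞` there is a monotone step profile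
`Rb ≤ cap`, `Rb → ∞`, with `β(t) Rb(t) ≤ s(t)` for all late `t`. Key inequality
(`cube_le_of_slack`): if `|β'| ≤ η` on `[t − B/(2η), t]` then `β(t)³ ≤ 8η s(t)/c` (on the last
stretch of length `β(t)/(2η)` the tilt coefficient is `≥ β(t)/2`); with `η = c s₀²/(8n³)` this gives
`β(t) n ≤ s(t)`.
[folklore real analysis]
-/

noncomputable section

set_option linter.dupNamespace false

open Set Filter Topology

namespace Summit.FinalStateConjecture.FinalStateConjecture.Theorems

/-- **Slack beats tilt, quantitatively.** Let `s, β` be differentiable on `ℝ` with `s' ≥ c β²`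
(`c > 0`), `s ≥ 0`, `β(t) ≥ 0`. If `|β'| ≤ η` on `[t − β(t)/(2η), t]` (`η > 0`), then
`c β(t)³ ≤ 8 η s(t)` (on that stretch `β ≥ β(t)/2`, so the slack gains `c (β(t)/2)² · β(t)/(2η)`).
[folklore] -/
theorem cube_le_of_slack {s β : ℝ → ℝ} {c η t : ℝ} (hc : 0 < c) (hη : 0 < η)
    (hsd : Differentiable ℝ s) (hβd : Differentiable ℝ β) (hs0 : ∀ τ, 0 ≤ s τ) (hβ0 : 0 ≤ β t)
    (hslack : ∀ τ, c * β τ ^ 2 ≤ deriv s τ)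
    (hβ' : ∀ τ ∈ Icc (t - β t / (2 * η)) t, |deriv β τ| ≤ η) :
    c * β t ^ 3 ≤ 8 * η * s t := by
  rcases hβ0.eq_or_lt with h0 | hpos
  · rw [← h0]; have := hs0 t; nlinarith
  set L : ℝ := β t / (2 * η) with hL
  have hL0 : 0 < L := by rw [hL]; positivity
  -- lower bound for `β` on `[t − L, t]`
  have hβlow : ∀ τ ∈ Icc (t - L) t, β t / 2 ≤ β τ := by
    intro τ hτ
    have hmv := (convex_Icc (t - L) t).image_sub_le_mul_sub_of_deriv_le
      (hβd.continuous.continuousOn) (hβd.differentiableOn.mono interior_subset)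
      (fun x hx ↦ (le_abs_self _).trans (hβ' x (interior_subset hx))) τ hτ t
      ⟨by linarith [hτ.2], le_rfl⟩ hτ.2
    have h1 : η * (t - τ) ≤ η * L := mul_le_mul_of_nonneg_left (by linarith [hτ.1]) hη.le
    have h2 : η * L = β t / 2 := by rw [hL]; field_simp
    linarith
  -- slack gained on `[t − L, t]`
  have hgain : c * (β t / 2) ^ 2 * (t - (t - L)) ≤ s t - s (t - L) :=
    (convex_Icc (t - L) t).mul_sub_le_image_sub_of_le_deriv hsd.continuous.continuousOn
      (hsd.differentiableOn.mono interior_subset)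
      (fun x hx ↦ by
        have hx' : x ∈ Icc (t - L) t := interior_subset hx
        have h1 := hβlow x hx'
        have h2 : (β t / 2) ^ 2 ≤ β x ^ 2 := pow_le_pow_left₀ (by linarith) h1 2
        exact (mul_le_mul_of_nonneg_left h2 hc.le).trans (hslack x))
      (t - L) ⟨le_rfl, by linarith⟩ t ⟨by linarith, le_rfl⟩ (by linarith)
  rw [sub_sub_cancel] at hgain
  have hsL := hs0 (t - L)
  have hkey : c * (β t / 2) ^ 2 * L = c * β t ^ 3 / (8 * η) := by
    rw [hL]; field_simp; ring
  rw [hkey] at hgain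
  rw [div_le_iff₀ (by positivity)] at hgain
  nlinarith

/-- From `c β³ ≤ 8η s`, `η = c s₀²/(8 n³)`, `0 < s₀ ≤ s`: `β n ≤ s`. [folklore] -/
theorem mul_le_of_cube_le {c s₀ s β n : ℝ} (hc : 0 < c) (hs₀ : 0 < s₀) (hs : s₀ ≤ s) (hn : 0 < n)
    (h : c * β ^ 3 ≤ 8 * (c * s₀ ^ 2 / (8 * n ^ 3)) * s) : β * n ≤ s := by
  have h1 : β ^ 3 ≤ s₀ ^ 2 * s / n ^ 3 := by
    have : 8 * (c * s₀ ^ 2 / (8 * n ^ 3)) * s = c * (s₀ ^ 2 * s / n ^ 3) := by field_simp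
    rw [this] at h
    exact le_of_mul_le_mul_left h hc
  have hs0 : 0 ≤ s := hs₀.le.trans hs
  have h2 : s₀ ^ 2 * s / n ^ 3 ≤ (s / n) ^ 3 := by
    rw [div_pow]
    refine div_le_div_of_nonneg_right ?_ (by positivity)
    have h4 : s₀ ^ 2 ≤ s ^ 2 := pow_le_pow_left₀ hs₀.le hs 2
    calc s₀ ^ 2 * s ≤ s ^ 2 * s := mul_le_mul_of_nonneg_right h4 hs0
      _ = s ^ 3 := by ring
  have h3 : β ≤ s / n := le_of_pow_le_pow_left₀ three_ne_zero (div_nonneg hs0 hn.le) (h1.trans h2)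
  rwa [le_div_iff₀ hn] at h3

/-- **The adapted meshing profile.** Let `s, β : ℝ → ℝ` be differentiable with `s' ≥ c β²` (`c > 0`),
`s ≥ s₀ > 0`, `0 ≤ β ≤ B` and `β' → 0`. Then for every monotone cap `cap → ∞` there is a monotone
profile `Rb ≤ cap` with `Rb → ∞` and `β(t) Rb(t) ≤ s(t)` for all late `t`. [folklore] -/
theorem exists_adapted_profile {s β : ℝ → ℝ} {c s₀ B : ℝ} (hc : 0 < c) (hs₀ : 0 < s₀) (hB : 0 ≤ B)
    (hsd : Differentiable ℝ s) (hβd : Differentiable ℝ β) (hs : ∀ t, s₀ ≤ s t)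
    (hβ0 : ∀ t, 0 ≤ β t) (hβB : ∀ t, β t ≤ B) (hslack : ∀ t, c * β t ^ 2 ≤ deriv s t)
    (hβ' : Tendsto (deriv β) atTop (𝓝 0)) (cap : ℝ → ℝ) (hcap : Monotone cap)
    (hcaptop : Tendsto cap atTop atTop) :
    ∃ Rb : ℝ → ℝ, Monotone Rb ∧ Tendsto Rb atTop atTop ∧ (∀ t, Rb t ≤ cap t) ∧
      ∃ T : ℝ, ∀ t, T ≤ t → β t * Rb t ≤ s t := by
  classical
  have hs0 : ∀ t, 0 ≤ s t := fun t ↦ hs₀.le.trans (hs t)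
  -- stage `n`: derivative threshold `η n` and a time `T n` after which `|β'| ≤ η n`
  set η : ℕ → ℝ := fun n ↦ c * s₀ ^ 2 / (8 * ((n : ℝ) + 1) ^ 3) with hη
  have hη0 : ∀ n, 0 < η n := fun n ↦ by rw [hη]; positivity
  have hT : ∀ n : ℕ, ∃ T : ℝ, ∀ τ, T ≤ τ → |deriv β τ| ≤ η n := fun n ↦ by
    obtain ⟨T, hT⟩ := (Metric.tendsto_atTop.mp hβ') (η n) (hη0 n)
    exact ⟨T, fun τ hτ ↦ by have := hT τ hτ; rw [dist_zero_right, Real.norm_eq_abs] at this; exact this.le⟩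
  choose T hT using hT
  -- monotone stage start times `S n`, with room for the window `B/(2 η n)`
  set S : ℕ → ℝ := fun n ↦ (Finset.range (n + 1)).sup' ⟨0, by simp⟩
    (fun k ↦ |T k| + B / (2 * η k) + k) with hSdef
  have hSge : ∀ n k, k ≤ n → |T k| + B / (2 * η k) + k ≤ S n := fun n k hk ↦
    Finset.le_sup' (fun k ↦ |T k| + B / (2 * η k) + (k : ℝ)) (Finset.mem_range.mpr (Nat.lt_succ_of_le hk))
  have hSmono : Monotone S := fun m n hmn ↦
    Finset.sup'_le _ _ fun k hk ↦ hSge n k ((Nat.lt_succ_iff.mp (Finset.mem_range.mp hk)).trans hmn)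
  have hSn : ∀ n : ℕ, (n : ℝ) ≤ S n := fun n ↦ by
    have h := hSge n n le_rfl
    have : 0 ≤ B / (2 * η n) := by positivity
    linarith [abs_nonneg (T n)]
  -- the stage index of a time: the number of stages already started
  set idx : ℝ → ℕ := fun t ↦ Nat.find (p := fun n ↦ t < S (n + 1)) (by
    obtain ⟨n, hn⟩ := exists_nat_gt t
    exact ⟨n, hn.trans_le ((hSn (n + 1)).trans' (by push_cast; linarith))⟩) with hidx
  have hidx_spec : ∀ t, t < S (idx t + 1) := fun t ↦ Nat.find_spec (p := fun n ↦ t < S (n + 1)) _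
  have hidx_min : ∀ t n, n < idx t → S (n + 1) ≤ t := fun t n hn ↦
    not_lt.mp (Nat.find_min (p := fun n ↦ t < S (n + 1)) _ hn)
  have hidx_mono : ∀ t t', t ≤ t' → idx t ≤ idx t' := by
    intro t t' htt'
    by_contra h
    push Not at h
    have h1 := hidx_min t (idx t') h
    have h2 := hidx_spec t'
    linarith
  have hidx_ge : ∀ t n, S n ≤ t → n ≤ idx t := by
    intro t n hn
    by_contra h
    push Not at h
    have h1 := hidx_spec t
    have h2 : S (idx t + 1) ≤ S n := hSmono h
    linarith
  -- the profile
  refine ⟨fun t ↦ min (idx t : ℝ) (cap t), fun t t' htt' ↦ ?_, ?_, fun t ↦ min_le_right _ _, ⟨S 0, fun t ht ↦ ?_⟩⟩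
  · exact min_le_min (by exact_mod_cast hidx_mono t t' htt') (hcap htt')
  · refine tendsto_atTop_atTop.mpr fun b ↦ ?_
    obtain ⟨n, hn⟩ := exists_nat_ge b
    obtain ⟨tc, htc⟩ := eventually_atTop.1 (tendsto_atTop.1 hcaptop b)
    refine ⟨max (S n) tc, fun t ht ↦ le_min ?_ (htc t ((le_max_right _ _).trans ht))⟩
    exact hn.trans (by exact_mod_cast hidx_ge t n ((le_max_left _ _).trans ht))
  · -- at stage `n = idx t`: `|β'| ≤ η n` on the window, so `β n ≤ s`, and `Rb t ≤ n`
    set n : ℕ := idx t with hn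
    have hβRb : β t * min (n : ℝ) (cap t) ≤ β t * n :=
      mul_le_mul_of_nonneg_left (min_le_left _ _) (hβ0 t)
    refine hβRb.trans ?_
    rcases Nat.eq_zero_or_pos n with hn0 | hnpos
    · rw [hn0, Nat.cast_zero, mul_zero]; exact hs0 t
    -- `S n ≤ t`
    have hSt : S n ≤ t := by
      have := hidx_min t (n - 1) (by omega)
      rwa [Nat.sub_add_cancel hnpos] at this
    have hwin : ∀ τ ∈ Icc (t - β t / (2 * η n)) t, |deriv β τ| ≤ η n := by
      intro τ hτ
      apply hT n
      have h1 := hSge n n le_rfl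
      have h2 : β t / (2 * η n) ≤ B / (2 * η n) :=
        div_le_div_of_nonneg_right (hβB t) (by positivity)
      linarith [hτ.1, (Nat.cast_nonneg n : (0 : ℝ) ≤ n), le_abs_self (T n)]
    have hcube := cube_le_of_slack hc (hη0 n) hsd hβd hs0 (hβ0 t) hslack hwin
    have hnR : (0 : ℝ) < (n : ℝ) + 1 := by positivity
    have h1 : β t * ((n : ℝ) + 1) ≤ s t :=
      mul_le_of_cube_le hc hs₀ (hs t) hnR (by rw [hη] at hcube; exact hcube)
    nlinarith [hβ0 t]

/-- Registered one-line form (stub `mul_le_of_cube_le_rechart` of the crux item) of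
`mul_le_of_cube_le`. [folklore] -/
theorem mul_le_of_cube_le_rechart : ∀ {c s₀ s β n : ℝ}, 0 < c → 0 < s₀ → s₀ ≤ s → 0 < n → c * β ^ 3 ≤ 8 * (c * s₀ ^ 2 / (8 * n ^ 3)) * s → β * n ≤ s :=
  fun hc hs₀ hs hn h ↦ mul_le_of_cube_le hc hs₀ hs hn h

end Summit.FinalStateConjecture.FinalStateConjecture.Theorems
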